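import Mathlib
import Summits.Ventures.PercRepro2.Defs
import Summits.Ventures.PercRepro2.Independence
import Summits.Ventures.PercRepro2.Harris
import Summits.Ventures.PercRepro2.Graph
import Summits.Ventures.PercRepro2.Events
import Summits.Ventures.PercRepro2.ZCTwoEdgeGraph
import Summits.Ventures.PercRepro2.ZCOTwoEdge

/-!
# Theorem D on the graph: (ZC) when the mark `o` has no neighbour outside `{a₁, a₃}`
(blind cell PercRepro2, mine-a g23; MINE-A.md §70.2)

The graph instance of `zc_o_two_edge`.  `ends : E → Sym2 V` is the edge-endpoint map, `f₁`, `f₂`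
are the two edges at `o` (`ends f₁ = s(o, a₁)`, `ends f₂ = s(o, a₃)`, and no other edge contains
`o`).  With `ω⁻ := ω[f₁ ↦ closed][f₂ ↦ closed]` (the configuration of `G − o`) the structural
lemmas of `ZCTwoEdgeGraph` apply with the degree-two vertex `o` in the role of the root there:
* `{a₁ ↔ o} = {f₁ open} ∪ ({f₂ open} ∩ {a₁ ↔ a₃ in ω⁻})`  (`conn_root_a3_iff`),
* `{a₃ ↔ o} = {f₂ open} ∪ ({f₁ open} ∩ {a₁ ↔ a₃ in ω⁻})`  (`conn_root_o_iff`),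
* `{a₁ ↔ a₃} = {a₁ ↔ a₃ in ω⁻} ∪ {f₁, f₂ open}`  (`conn_a3_o_iff`),
* `C(o) = {o} ∪ (C⁻(a₁) if f₁ open) ∪ (C⁻(a₃) if f₂ open)`  (`cluster_root_eq`),
* `C(a₁) = C⁻(a₁)` when `o ∉ C(a₁)`  (from the closure lemma `mem_cluster_closeTwo_of_conn`, inline),
and the abstract theorem applies with `A' = {a₁ ↔ a₃ in ω⁻}`, `X₀ = {C⁻(a₁) ∈ 𝓔}`,
`X₁ = {{o} ∪ C⁻(a₁) ∈ 𝓔}`, `X₃ = {{o} ∪ C⁻(a₁) ∪ C⁻(a₃) ∈ 𝓔}` for any up-set `𝓔` of vertex sets.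
With `zc_two_edge_graph` (Theorem A, `a₁` of degree two) and `zc_a3_two_edge_graph` (Theorem C,
`a₃` of degree two) this closes (ZC) on the three classes «one of the marks has no neighbour
outside the other two».  One seat.
-/

namespace Summit.Ventures.PercRepro2

section GraphTheoremD

variable {V : Type*} {E : Type*} [Fintype E] [DecidableEq E] {R : Type*} [CommRing R]
  [LinearOrder R] [IsStrictOrderedRing R]

/-- **Theorem D on the graph (MINE-A.md §70.2).**  Bond percolation on a finite graph `(V, E, ends)`
whose mark `o` is joined to the rest only by `f₁ = oa₁` and `f₂ = oa₃`; `𝓔` an up-set of vertex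
sets.  With `e = {a₁ ↔ a₃}`, `L = {a₁ ↔ o}`, `U = {C(a₁) ∈ 𝓔}`, `γ = {a₃ ↔ o}`,
`B = eᶜ ∩ Lᶜ ∩ γ = [a₁ | a₃ o]`, `D = eᶜ ∩ Lᶜ ∩ γᶜ = [a₁ | a₃ | o]`:
  `P(D) · Cov(U, e ∩ L) − P(B) · Cov(U, e ∩ Lᶜ)`
  `≥ (1 − p f₁)(1 − p f₂)(1 − μ) · [p f₁ (1 − p f₂) ((1 − μ) P(X₃ ∩ A') − μ P(X₃ ∩ A'ᶜ)) + (1 − p f₁) p f₂ (P(X₁ ∩ A') − P(X₀ ∩ A'))]`,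
where `A' = {a₁ ↔ a₃ in ω⁻}` (off `o`), `μ = P(A')`, `X₀ = {C⁻(a₁) ∈ 𝓔}`, `X₁ = {{o} ∪ C⁻(a₁) ∈ 𝓔}`
and `X₃ = {{o} ∪ C⁻(a₁) ∪ C⁻(a₃) ∈ 𝓔}`.  The bound is nonnegative by the Harris inequality between
`X₃` and `A'` (`zc_o_two_edge_graph_nonneg`): this is (ZC) `P(D) Cov(U, eL) ≥ P(B) Cov(U, e¬L)` on
the class «`o` has no neighbour outside `{a₁, a₃}`», every weight vector, every cluster up-set. -/
theorem zc_o_two_edge_graph {p : E → R} (hp : IsProbVec p) {ends : E → Sym2 V} {a₁ a₃ o : V}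
    {f₁ f₂ : E} (hf : f₁ ≠ f₂) (hends₁ : ends f₁ = s(o, a₁)) (hends₂ : ends f₂ = s(o, a₃))
    (hmark : ∀ e, o ∈ ends e → e = f₁ ∨ e = f₂) (ho1 : o ≠ a₁) (ho3 : o ≠ a₃)
    {𝓔 : Set (Set V)} (h𝓔 : IsUpperSet 𝓔) :
    let e := connEvent ends a₁ a₃
    let L := connEvent ends a₁ o
    let U := clusterInEvent ends a₁ 𝓔
    let γ := connEvent ends a₃ o
    let A' : Set (Config E) := {ω | Conn ends (Function.update (Function.update ω f₁ false) f₂ false) a₁ a₃}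
    let X₀ : Set (Config E) :=
      {ω | cluster ends (Function.update (Function.update ω f₁ false) f₂ false) a₁ ∈ 𝓔}
    let X₁ : Set (Config E) :=
      {ω | {o} ∪ cluster ends (Function.update (Function.update ω f₁ false) f₂ false) a₁ ∈ 𝓔}
    let X₃ : Set (Config E) :=
      {ω | {o} ∪ cluster ends (Function.update (Function.update ω f₁ false) f₂ false) a₁ ∪ cluster ends (Function.update (Function.update ω f₁ false) f₂ false) a₃ ∈ 𝓔}
    prob p (eᶜ ∩ Lᶜ ∩ γᶜ) * (prob p (U ∩ (e ∩ L)) - prob p U * prob p (e ∩ L))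
      - prob p (eᶜ ∩ Lᶜ ∩ γ) * (prob p (U ∩ (e ∩ Lᶜ)) - prob p U * prob p (e ∩ Lᶜ))
      ≥ (1 - p f₁) * (1 - p f₂) * (1 - prob p A') *
          (p f₁ * (1 - p f₂)
              * ((1 - prob p A') * prob p (X₃ ∩ A') - prob p A' * prob p (X₃ ∩ A'ᶜ))
            + (1 - p f₁) * p f₂ * (prob p (X₁ ∩ A') - prob p (X₀ ∩ A'))) := by
  intro e L U γ A' X₀ X₁ X₃
  -- the four graph events in the abstract form
  have hconn : ∀ ω : Config E, Conn ends ω a₁ o ↔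
      ω f₁ = true ∨ (ω f₂ = true ∧ ω ∈ A') := by
    intro ω
    constructor
    · intro h
      exact (conn_root_a3_iff hf hends₁ hends₂ hmark ho1 ω).1 (conn_symm h)
    · intro h
      exact conn_symm ((conn_root_a3_iff hf hends₁ hends₂ hmark ho1 ω).2 h)
  have hL : L = openEdge f₁ ∪ (openEdge f₂ ∩ A') := by
    ext ω
    simp only [L, Set.mem_union, Set.mem_inter_iff, mem_connEvent, mem_openEdge]
    exact hconn ω
  have he : e = A' ∪ (openEdge f₁ ∩ openEdge f₂) := by
    ext ω
    simp only [e, A', Set.mem_union, Set.mem_inter_iff, Set.mem_setOf_eq, mem_connEvent,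
      mem_openEdge]
    exact conn_a3_o_iff hf hends₁ hends₂ hmark ho1 ho3 ω
  have hγ : γ = openEdge f₂ ∪ (openEdge f₁ ∩ A') := by
    ext ω
    simp only [γ, A', Set.mem_union, Set.mem_inter_iff, Set.mem_setOf_eq, mem_connEvent,
      mem_openEdge]
    constructor
    · intro h
      exact (conn_root_o_iff hf hends₁ hends₂ hmark ho3 ω).1 (conn_symm h)
    · intro h
      exact conn_symm ((conn_root_o_iff hf hends₁ hends₂ hmark ho3 ω).2 h)
  have hU : U = (openEdge f₁ ∩ openEdge f₂ ∩ X₃) ∪ (L ∩ (openEdge f₁ ∩ openEdge f₂)ᶜ ∩ X₁)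
      ∪ (Lᶜ ∩ X₀) := by
    ext ω
    by_cases hLo : Conn ends ω a₁ o
    · have hLo' := hLo
      rw [hconn] at hLo'
      simp only [U, X₃, X₁, X₀, L, Set.mem_union, Set.mem_inter_iff, Set.mem_compl_iff,
        Set.mem_setOf_eq, mem_clusterInEvent, mem_openEdge, mem_connEvent]
      rw [cluster_eq_of_conn hLo, cluster_root_eq hf hends₁ hends₂ hmark ω]
      rcases Bool.eq_false_or_eq_true (ω f₁) with hf1 | hf1 <;>
        rcases Bool.eq_false_or_eq_true (ω f₂) with hf2 | hf2
      · simp [hf1, hf2, hLo, -mem_cluster]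
      · simp [hf1, hf2, hLo, -mem_cluster]
      · -- `f₁` closed, `f₂` open: the connection forces `A'`, and then `C⁻(a₃) = C⁻(a₁)`
        have hA : ω ∈ A' := by
          rcases hLo' with h | ⟨_, h⟩
          · rw [hf1] at h; exact absurd h Bool.false_ne_true
          · exact h
        have hco : cluster ends (Function.update (Function.update ω f₁ false) f₂ false) a₃
            = cluster ends (Function.update (Function.update ω f₁ false) f₂ false) a₁ :=
          (cluster_eq_of_conn hA).symm
        simp [hf1, hf2, hLo, hco, -mem_cluster]
      · exfalso
        rcases hLo' with h | ⟨h, _⟩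
        · rw [hf1] at h; exact Bool.false_ne_true h
        · rw [hf2] at h; exact Bool.false_ne_true h
    · have hno : ¬ Conn ends ω o a₁ := fun h => hLo (conn_symm h)
      have hLo' := hLo
      rw [hconn] at hLo'
      simp only [U, X₃, X₁, X₀, L, Set.mem_union, Set.mem_inter_iff, Set.mem_compl_iff,
        Set.mem_setOf_eq, mem_clusterInEvent, mem_openEdge, mem_connEvent]
      have hcl : cluster ends ω a₁
          = cluster ends (Function.update (Function.update ω f₁ false) f₂ false) a₁ := by
        apply Set.Subset.antisymm
        · intro u hu
          refine mem_cluster_closeTwo_of_conn hf hends₁ hends₂ hmark (Ne.symm ho1) ?_ ?_ hu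
          · intro h1 _
            exact hno (conn_of_openAdj ⟨f₁, h1, hends₁⟩)
          · intro h2 h3
            exact hno (conn_trans (conn_of_openAdj ⟨f₂, h2, hends₂⟩)
              (conn_symm (conn_mono (closeTwo_le f₁ f₂ ω) h3)))
        · exact cluster_mono (closeTwo_le f₁ f₂ ω) a₁
      rw [hcl]
      have hf1 : ω f₁ = false := by
        rcases Bool.eq_false_or_eq_true (ω f₁) with h | h
        · exact absurd (Or.inl h) hLo'
        · exact h
      simp [hf1, hLo, -mem_cluster]
  -- the hypotheses of the abstract theorem
  have hA' : ∀ (ω : Config E) (b₁ b₂ : Bool),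
      Function.update (Function.update ω f₁ b₁) f₂ b₂ ∈ A' ↔ ω ∈ A' := by
    intro ω b₁ b₂; simp only [A', Set.mem_setOf_eq, closeTwo_update]
  have hX₀ : ∀ (ω : Config E) (b₁ b₂ : Bool),
      Function.update (Function.update ω f₁ b₁) f₂ b₂ ∈ X₀ ↔ ω ∈ X₀ := by
    intro ω b₁ b₂; simp only [X₀, Set.mem_setOf_eq, closeTwo_update]
  have hX₁ : ∀ (ω : Config E) (b₁ b₂ : Bool),
      Function.update (Function.update ω f₁ b₁) f₂ b₂ ∈ X₁ ↔ ω ∈ X₁ := by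
    intro ω b₁ b₂; simp only [X₁, Set.mem_setOf_eq, closeTwo_update]
  have hX₃ : ∀ (ω : Config E) (b₁ b₂ : Bool),
      Function.update (Function.update ω f₁ b₁) f₂ b₂ ∈ X₃ ↔ ω ∈ X₃ := by
    intro ω b₁ b₂; simp only [X₃, Set.mem_setOf_eq, closeTwo_update]
  have h13 : X₁ ∩ A' = X₃ ∩ A' := by
    ext ω
    simp only [X₁, X₃, A', Set.mem_inter_iff, Set.mem_setOf_eq]
    constructor
    · rintro ⟨h, hc⟩
      refine ⟨?_, hc⟩
      rw [← cluster_eq_of_conn hc, Set.union_assoc, Set.union_self]; exact h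
    · rintro ⟨h, hc⟩
      refine ⟨?_, hc⟩
      rw [← cluster_eq_of_conn hc, Set.union_assoc, Set.union_self] at h; exact h
  have h01 : X₀ ⊆ X₁ := fun ω hω => h𝓔 Set.subset_union_right hω
  have h13s : X₁ ⊆ X₃ := fun ω hω => h𝓔 Set.subset_union_left hω
  have key := zc_o_two_edge hp hf hA' hX₀ hX₁ hX₃ h13 h01 h13s
  simp only at key
  rw [hU, he, hL, hγ]
  exact key

/-- **Theorem D on the graph, the sign**: (ZC) `P(D) Cov(U, eL) ≥ P(B) Cov(U, e¬L)` holds on every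
finite graph in which `o` has no neighbour outside `{a₁, a₃}`, for every weight vector and every
cluster up-set `𝓔`. -/
theorem zc_o_two_edge_graph_nonneg {p : E → R} (hp : IsProbVec p) {ends : E → Sym2 V}
    {a₁ a₃ o : V} {f₁ f₂ : E} (hf : f₁ ≠ f₂) (hends₁ : ends f₁ = s(o, a₁))
    (hends₂ : ends f₂ = s(o, a₃)) (hmark : ∀ e, o ∈ ends e → e = f₁ ∨ e = f₂) (ho1 : o ≠ a₁)
    (ho3 : o ≠ a₃) {𝓔 : Set (Set V)} (h𝓔 : IsUpperSet 𝓔) :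
    let e := connEvent ends a₁ a₃
    let L := connEvent ends a₁ o
    let U := clusterInEvent ends a₁ 𝓔
    let γ := connEvent ends a₃ o
    0 ≤ prob p (eᶜ ∩ Lᶜ ∩ γᶜ) * (prob p (U ∩ (e ∩ L)) - prob p U * prob p (e ∩ L))
      - prob p (eᶜ ∩ Lᶜ ∩ γ) * (prob p (U ∩ (e ∩ Lᶜ)) - prob p U * prob p (e ∩ Lᶜ)) := by
  intro e L U γ
  have h := zc_o_two_edge_graph hp hf hends₁ hends₂ hmark ho1 ho3 h𝓔
  simp only at h
  refine le_trans ?_ h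
  set A' : Set (Config E) := {ω | Conn ends (Function.update (Function.update ω f₁ false) f₂ false) a₁ a₃} with hA'def
  set X₀ : Set (Config E) :=
    {ω | cluster ends (Function.update (Function.update ω f₁ false) f₂ false) a₁ ∈ 𝓔} with hX₀def
  set X₁ : Set (Config E) :=
    {ω | {o} ∪ cluster ends (Function.update (Function.update ω f₁ false) f₂ false) a₁ ∈ 𝓔} with hX₁def
  set X₃ : Set (Config E) :=
    {ω | {o} ∪ cluster ends (Function.update (Function.update ω f₁ false) f₂ false) a₁ ∪ cluster ends (Function.update (Function.update ω f₁ false) f₂ false) a₃ ∈ 𝓔} with hX₃def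
  have hA'up : IsUpperSet A' := fun ω ω' hle hω => conn_mono (closeTwo_mono f₁ f₂ hle) hω
  have hX₃up : IsUpperSet X₃ := by
    intro ω ω' hle hω
    refine h𝓔 ?_ hω
    exact Set.union_subset_union (Set.union_subset_union_right _
      (cluster_mono (closeTwo_mono f₁ f₂ hle) a₁)) (cluster_mono (closeTwo_mono f₁ f₂ hle) a₃)
  have h01 : X₀ ⊆ X₁ := fun ω hω => h𝓔 Set.subset_union_right hω
  have hHar : (prob p (X₃ ∩ A') + prob p (X₃ ∩ A'ᶜ)) * prob p A' ≤ prob p (X₃ ∩ A') := by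
    have := prob_mul_prob_le_prob_inter hp hX₃up hA'up
    rwa [← prob_inter_add_prob_inter_compl p X₃ A'] at this
  have hca : prob p (X₀ ∩ A') ≤ prob p (X₁ ∩ A') :=
    prob_mono hp (Set.inter_subset_inter_left _ h01)
  have h1q : 0 ≤ 1 - p f₁ := sub_nonneg.2 (hp.le_one f₁)
  have h1r : 0 ≤ 1 - p f₂ := sub_nonneg.2 (hp.le_one f₂)
  have h1μ : 0 ≤ 1 - prob p A' := sub_nonneg.2 (prob_le_one hp _)
  have hHar' : 0 ≤ (1 - prob p A') * prob p (X₃ ∩ A') - prob p A' * prob p (X₃ ∩ A'ᶜ) := by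
    linarith
  exact mul_nonneg (mul_nonneg (mul_nonneg h1q h1r) h1μ)
    (add_nonneg (mul_nonneg (mul_nonneg (hp.nonneg f₁) h1r) hHar')
      (mul_nonneg (mul_nonneg h1q (hp.nonneg f₂)) (sub_nonneg.2 hca)))

end GraphTheoremD

end Summit.Ventures.PercRepro2
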